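import Literature.NumberTheory.EllipticCurves.HeegnerEnvelopeDescentLucasProofs
import Literature.NumberTheory.EllipticCurves.CompactSelmerKrullTransportProofs
import HarnessLib

/-!
# The Heegner-module envelope by UNIVERSAL NORMS: `ℋ_∞(F) ⊆ Λκ_∞(C)` ON THE NOSE (no `p`-power) for a
# coherent pair `(C, F)` (CGLS 2022 Rem. 4.1.4 «`κ_∞` and `κ₁^{Hg}` generate the same `Λ`-submodule»;
# Howard 2004 Thm. 3.3.7 «`𝐇` is generated by `κ̃₁`»; Perrin-Riou 1987 §3.4; proofs file)

Topic `NumberTheory/EllipticCurves`. THEOREMS ONLY (no definition, no named fact, no `sorry`); sequel of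
`CompactSelmerTowerNormProofs` and `HeegnerEnvelopeDescentProofs`. Written by the cell `bsd-print-x9` seat
`bsd-line-x9-p2` for the stub `stub_envelopeTied` of crux stmt-BirchSwinnertonDyer-26359
`PrintX9.HowardContainmentLightFramePinnedOfPrint` (the FORWARD inclusion of the envelope, with exponent `e = 0`).

THE ARGUMENT. Fix a layer `k > δ`. LEVELWISE, Howard's module `ℋ̄_k(F) = ℤ_p[G_k]·{δy, δz_0, …, δz_k}` is NOT
inside `ℤ_p[G_k]·κ_k` (e.g. `y_K` is not a universal norm), but it is modulo the RESIDUAL module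
`R_k = ℤ_p[G_k]·{δ(r)}` spanned by the Kummer images of finitely many points `r` rational over `K_{δ+1}`
(`y`, `z_j` for `j ≤ δ`, and `v_{δ+1}`): `ℋ̄_ℓ ⊆ ℤ_p[G_ℓ]κ_ℓ + R_ℓ` for every `ℓ > δ`, by the descent of
`HeegnerEnvelopeDescent(Lucas)Proofs` ((P1′), (P1″), (P2′)) and the identity (P3) `z_j = a u_j + b v_j`. For an element `s` of
`ℋ_∞(F)` (all projections in the `ℋ̄_ℓ`), the universal-norm relation `res_{k→k+n} proj_k s = 𝒩_{k+n→k} proj_{k+n} s`,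
the norm compatibility `𝒩 κ_{k+n} ∈ ℤ_p^× · res κ_k`, and `𝒩 δ_{k+n}(r) = pⁿ · res δ_k(r)` (the `r` are
`K_k`-rational) give `res proj_k s ∈ res(ℤ_p[G_k]κ_k + pⁿ R_k)` for EVERY `n`; restriction is injective
(`E(K)[p] = 0`), `R_k` is a finitely generated `ℤ_p`-module, and Krull's intersection theorem
(`⋂_n (M + pⁿR) = M`, via `(ι → ℤ_p)/Φ⁻¹(M)`) yields `proj_k s ∈ ℤ_p[G_k]κ_k`. No Euler factor is inverted and no
class-number / anomalous-prime hypothesis enters.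

WHAT (the Krull step and the abstract transport predicate are in `CompactSelmerKrullTransportProofs`; the
operator algebra, universal norms and injectivity in `CompactSelmerTowerNormProofs`; the descent of the
stabilised differences in `HeegnerEnvelopeDescentProofs` / `HeegnerEnvelopeDescentLucasProofs`).
* §3 `exists_proj_eq_add_sum_residual` — for `s` with `proj_ℓ s ∈ ℋ̄_ℓ(F)` (`ℓ = k + n`):
  `proj_k s ∈ ℤ_p[G_k]κ_k + pⁿ R_k` explicitly.
* §4 **`heegnerModule_le_stabilizedHeegnerModule_of_coherent`** — `ℋ_∞(F) ≤ Λκ_∞(C)` from (P1′)/(P1″)/(P2′)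
  (any integer Lucas pair, any jumps) and (P3), `IsOrdinaryAt W p`, `γ` a topological generator and `E(K)[p] = 0`.
HONEST FRAMING: module bookkeeping over printed distribution relations; nothing about any particular curve;
BSD is not proved by any of this.

References: [CastellaGrossiLeeSkinner2022] Rem. 4.1.4 (arXiv:2008.02571v2 TeX L2278–2294); [Howard2004HeegnerKolyvagin]
§3.3, Thm. 3.3.7; [PerrinRiou1987BSMF] §0 p. 402 (universal norms), §3.4 Prop. 10; [GreenbergLNM1716] §3
Lemma 3.1; [Washington1997] §13.2; Krull's intersection theorem (Mathlib `Ideal.iInf_pow_smul_eq_bot_of_isLocalRing`).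
-/

set_option autoImplicit false

noncomputable section

open scoped Classical

open WeierstrassCurve Literature.NumberTheory.EllipticCurves
  Literature.NumberTheory.EllipticCurves.CastellaGrossiLeeSkinner2022 PowerSeries

universe u

namespace Literature.NumberTheory.EllipticCurves

/-! ## §3 `proj_k s ∈ ℤ_p[G_k]κ_k + pⁿ R_k` -/

section Residual

variable {N : ℕ} [NeZero N] {W : WeierstrassCurve ℚ} [W.IsGloballyMinimal] [W.IsElliptic] {K : Type u}
  [Field K] [NumberField K] {p : ℕ} [Fact p.Prime] {κ : ZpExtension K p} {γ : Field.absoluteGaloisGroup K}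
  {jbar : AlgebraicClosure K →+* ℂ} (D : (W.baseChange K).LambdaAdicSelmerData κ γ)
  (F : HeegnerFamily N W K κ jbar) (C : StabilizedHeegnerData N W K κ jbar)

/-- **`proj_k s ∈ ℤ_p[G_k]κ_k + pⁿ R_k`.** Let `(C, F)` satisfy (P1′)/(P1″)/(P2′) for an integer Lucas pair `(A, B)`
and jumps `ns`, and (P3); `p` good ordinary, `γ` a topological
generator, `E(K)[p] = 0`; let `k > δ`, `n ≥ 0`, and let `ρ : ι → E(K̄)` be a finite family of points fixed by
`Gal(K̄/K_{δ+1})` through which `y`, the `z_j` (`j ≤ δ`) and `v_{δ+1}` factor, with Kummer families `r_a` over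
`K_k`. Then for every `s ∈ 𝔖` whose projection to layer `k + n` lies in `ℋ̄_{k+n}(F)` there are
`m ∈ ℤ_p[G_k]κ_k` and `f` with `proj_k s = m + Σ_{(a,t)} pⁿ f_{a,t} · conj_{γ^t} r_a`.
[cite: CastellaGrossiLeeSkinner2022, Rem. 4.1.4 (κ_∞ = lim← κ_k)] [cite: PerrinRiou1987BSMF, §0 p. 402 and §3.4]
[cite: Howard2004HeegnerKolyvagin, §3.3 (H_k, 𝐇 = lim← H_k)] -/
theorem exists_proj_eq_add_sum_residual (hord : IsOrdinaryAt W p) (hγ : κ.IsTopGenerator γ)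
    (hE : ∀ P : (W.baseChange K).toAffine.Point, p • P = 0 → P = 0)
    (A B : ℕ → ℤ) (hA0 : A 0 = 1) (hA1 : A 1 = W.frobeniusTrace p)
    (hA : ∀ m, A (m + 2) = W.frobeniusTrace p * A (m + 1) - p * A m)
    (hB0 : B 0 = 0) (hB1 : B 1 = -1) (hB : ∀ m, B (m + 2) = W.frobeniusTrace p * B (m + 1) - p * B m)
    (ns : ℕ → ℕ) (hv1 : ∀ j, C.depth < j → C.v (j + 1) = A (ns j) • C.u j + B (ns j) • C.v j)
    (hvfix : ∀ j, C.depth < j → ∀ σ ∈ κ.layerSubgroup j, σ • C.v (j + 1) = C.v (j + 1))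
    (hnorm : ∀ j, C.depth < j →
      ∑ i ∈ Finset.range p, (γ ^ (p ^ j * i)) • C.u (j + 1) = A (ns j + 1) • C.u j + B (ns j + 1) • C.v j)
    (hz : ∀ j, C.depth < j → ∃ a b : ℤ, F.z j = a • C.u j + b • C.v j)
    {k : ℕ} (hk : C.depth < k) (n : ℕ)
    {ι : Type} [Fintype ι] (ρ : ι → geomPoints (W.baseChange K))
    (hρ : ∀ a, ∀ σ ∈ κ.layerSubgroup (C.depth + 1), σ • ρ a = ρ a)
    (hyρ : ∃ a, ρ a = F.y) (hzρ : ∀ j, j ≤ C.depth → ∃ a, ρ a = F.z j) (hvρ : ∃ a, ρ a = C.v (C.depth + 1))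
    (r : ι → (W.baseChange K).torsionH1Pi p (κ.layerSubgroup k))
    (hr : ∀ a, (W.baseChange K).IsKummerFamilyOver p (κ.layerSubgroup k)
      (fun σ hσ ↦ hρ a σ (κ.layerSubgroup_antitone (Nat.succ_le_of_lt hk) hσ)) (r a))
    (s : D.S) (hs : D.proj (k + n) s ∈ heegnerModuleLayer γ F (k + n)) :
    ∃ m ∈ stabilizedModuleLayer γ C k hk, ∃ f : ι × Fin (p ^ k) → ℤ_[p],
      D.proj k s = m + ∑ b, (W.baseChange K).padicPi p (κ.layerSubgroup k) ((p : ℤ_[p]) ^ n * f b)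
        ((W.baseChange K).conjPi p (κ.layerSubgroup k) (γ ^ (b.2 : ℕ)) (r b.1)) := by
  have hp : p.Prime := Fact.out
  haveI : NeZero (p ^ k) := ⟨pow_ne_zero _ hp.ne_zero⟩
  have hℓk : κ.layerSubgroup (k + n) ≤ κ.layerSubgroup k := κ.layerSubgroup_antitone (Nat.le_add_right k n)
  have hkℓ' : C.depth < k + n := by omega
  have hunit : IsUnit (unitRoot W p) := (unitRoot_spec_holds W p hord).2
  have hρk : ∀ a, ∀ σ ∈ κ.layerSubgroup k, σ • ρ a = ρ a :=
    fun a σ hσ ↦ hρ a σ (κ.layerSubgroup_antitone (Nat.succ_le_of_lt hk) hσ)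
  have hρℓ : ∀ a, ∀ σ ∈ κ.layerSubgroup (k + n), σ • ρ a = ρ a := fun a σ hσ ↦ hρk a σ (hℓk hσ)
  -- the residual span map `Ψ f = Σ_b f_b · conj_{γ^{b.2}} r_{b.1}` over `K_k`
  obtain ⟨r', hr'⟩ : ∃ r' : ι × Fin (p ^ k) → (W.baseChange K).torsionH1Pi p (κ.layerSubgroup k),
      ∀ b, r' b = (W.baseChange K).conjPi p (κ.layerSubgroup k) (γ ^ (b.2 : ℕ)) (r b.1) := ⟨_, fun _ ↦ rfl⟩
  obtain ⟨Ψ, hΨ, hΨc⟩ := (W.baseChange K).exists_addMonoidHom_padicPi_sum p (κ.layerSubgroup k) r'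
  -- the norm operator `𝒩 = Σ_{i<pⁿ} conj_{γ^{p^k i}}` over `K_{k+n}` and the restriction `res`
  obtain ⟨𝒩, h𝒩ap⟩ : ∃ 𝒩 : (W.baseChange K).torsionH1Pi p (κ.layerSubgroup (k + n)) →+
      (W.baseChange K).torsionH1Pi p (κ.layerSubgroup (k + n)),
      ∀ x, 𝒩 x = ∑ i ∈ Finset.range (p ^ n),
        (W.baseChange K).conjPi p (κ.layerSubgroup (k + n)) (γ ^ (p ^ k * i)) x :=
    ⟨∑ i ∈ Finset.range (p ^ n), (W.baseChange K).conjPi p (κ.layerSubgroup (k + n)) (γ ^ (p ^ k * i)),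
      fun x ↦ by rw [AddMonoidHom.finsetSum_apply]⟩
  obtain ⟨res, hres⟩ : ∃ res : (W.baseChange K).torsionH1Pi p (κ.layerSubgroup k) →+
      (W.baseChange K).torsionH1Pi p (κ.layerSubgroup (k + n)), ∀ y, res y = (W.baseChange K).resPi p hℓk y :=
    ⟨_, fun _ ↦ rfl⟩
  obtain ⟨q, hq⟩ : ∃ q : ℤ_[p], q = (p : ℤ_[p]) ^ n := ⟨_, rfl⟩
  -- (T1) transport under the `ℤ_p`-action
  have Tc : ∀ (c : ℤ_[p]) {x : (W.baseChange K).torsionH1Pi p (κ.layerSubgroup (k + n))},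
      (∃ m ∈ stabilizedModuleLayer γ C k hk, ∃ f, 𝒩 x = res (m + Ψ (q • f))) →
      ∃ m ∈ stabilizedModuleLayer γ C k hk, ∃ f,
        𝒩 ((W.baseChange K).padicPi p (κ.layerSubgroup (k + n)) c x) = res (m + Ψ (q • f)) := by
    intro c x hx
    refine exists_norm_eq_res_map 𝒩 res _ Ψ q ((W.baseChange K).padicPi p (κ.layerSubgroup (k + n)) c)
      ((W.baseChange K).padicPi p (κ.layerSubgroup k) c) (c • LinearMap.id)
      (fun x ↦ ?_) (fun y ↦ ?_) (fun m hm ↦ padicPi_mem_stabilizedModuleLayer γ C k hk c hm) (fun f ↦ ?_) hx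
    · rw [h𝒩ap, h𝒩ap, sum_conjPi_padicPi]
    · rw [hres, hres, resPi_padicPi]
    · rw [LinearMap.smul_apply, LinearMap.id_apply, hΨc]
  -- (T2) transport under `conj_{γ^i}`
  have Tconj : ∀ (i : ℕ) {x : (W.baseChange K).torsionH1Pi p (κ.layerSubgroup (k + n))},
      (∃ m ∈ stabilizedModuleLayer γ C k hk, ∃ f, 𝒩 x = res (m + Ψ (q • f))) →
      ∃ m ∈ stabilizedModuleLayer γ C k hk, ∃ f,
        𝒩 ((W.baseChange K).conjPi p (κ.layerSubgroup (k + n)) (γ ^ i) x) = res (m + Ψ (q • f)) := by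
    intro i x hx
    -- the shift `t ↦ t + i` on `Fin (p^k)`
    let i' : Fin (p ^ k) := ⟨i % p ^ k, Nat.mod_lt _ (pow_pos hp.pos k)⟩
    let e : ι × Fin (p ^ k) ≃ ι × Fin (p ^ k) := Equiv.prodCongr (Equiv.refl ι) (Equiv.addRight i')
    have he1 : ∀ b, (e b).1 = b.1 := fun _ ↦ rfl
    have he2 : ∀ b, ((e b).2 : ℕ) = ((b.2 : ℕ) + i % p ^ k) % p ^ k := fun b ↦ by
      show (((b.2 + i' : Fin (p ^ k)) : ℕ)) = _
      rw [Fin.val_add]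
    refine exists_norm_eq_res_map 𝒩 res _ Ψ q ((W.baseChange K).conjPi p (κ.layerSubgroup (k + n)) (γ ^ i))
      ((W.baseChange K).conjPi p (κ.layerSubgroup k) (γ ^ i)) (LinearMap.funLeft ℤ_[p] ℤ_[p] e.symm)
      (fun x ↦ ?_) (fun y ↦ ?_) (fun m hm ↦ conjPi_pow_mem_stabilizedModuleLayer γ C k hk i hm) (fun f ↦ ?_) hx
    · rw [h𝒩ap, h𝒩ap, sum_conjPi_pow_conjPi_pow]
    · rw [hres, hres, resPi_conjPi]
    · rw [hΨ, hΨ, map_sum]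
      have hterm : ∀ b : ι × Fin (p ^ k),
          (W.baseChange K).conjPi p (κ.layerSubgroup k) (γ ^ i)
              ((W.baseChange K).padicPi p (κ.layerSubgroup k) (f b) (r' b)) =
            (W.baseChange K).padicPi p (κ.layerSubgroup k) (f b) (r' (e b)) := by
        intro b
        have hmod : (i + (b.2 : ℕ)) % p ^ k = ((b.2 : ℕ) + i % p ^ k) % p ^ k := by
          rw [add_comm, Nat.add_mod, Nat.mod_eq_of_lt b.2.isLt]
        rw [conjPi_padicPi_comm, hr', hr', he1, he2, ← conjPi_mul, ← pow_add,
          (W.baseChange K).conjPi_pow_eq_conjPi_pow_mod p κ hγ k (i + (b.2 : ℕ)), hmod]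
      rw [Finset.sum_congr rfl fun b _ ↦ hterm b,
        ← Equiv.sum_comp e (fun b ↦ (W.baseChange K).padicPi p (κ.layerSubgroup k)
          (LinearMap.funLeft ℤ_[p] ℤ_[p] e.symm f b) (r' b))]
      refine Finset.sum_congr rfl fun b _ ↦ ?_
      rw [LinearMap.funLeft_apply, Equiv.symm_apply_apply]
  -- (T3) the residual Kummer families: `𝒩 δ_{k+n}(ρ a) = pⁿ · res r_a`
  have Tres : ∀ (a : ι) {d : (W.baseChange K).torsionH1Pi p (κ.layerSubgroup (k + n))},
      (W.baseChange K).IsKummerFamilyOver p (κ.layerSubgroup (k + n)) (hρℓ a) d →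
      ∃ m ∈ stabilizedModuleLayer γ C k hk, ∃ f, 𝒩 d = res (m + Ψ (q • f)) := by
    intro a d hd
    have hdres : d = res (r a) := by
      rw [hres]; exact (W.baseChange K).eq_resPi_of_isKummerFamilyOver p κ hℓk (hρk a) (hr a) hd
    refine ⟨0, AddSubgroup.zero_mem _, Pi.single (a, (0 : Fin (p ^ k))) 1, ?_⟩
    rw [h𝒩ap, (W.baseChange K).sum_conjPi_eq_pow_smul_of_isKummerFamilyOver p κ hγ hℓk (hρk a) hd, hdres,
      ← map_zsmul, zero_add, hΨ, Fintype.sum_eq_single (a, (0 : Fin (p ^ k)))]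
    · rw [hr']
      simp only [Pi.smul_apply, Pi.single_eq_same, smul_eq_mul, mul_one, Fin.val_zero, pow_zero, conjPi_one]
      rw [hq, ← padicPi_intCast, Int.cast_pow, Int.cast_natCast]
    · intro b hb
      rw [Pi.smul_apply, Pi.single_eq_of_ne hb, smul_zero, padicPi_zero_left]
  -- (T4) the stabilised module over `K_{k+n}`: `𝒩 κ_{k+n} ∈ ℤ_p · res κ_k`
  have TM : ∀ x ∈ stabilizedModuleLayer γ C (k + n) hkℓ',
      ∃ m ∈ stabilizedModuleLayer γ C k hk, ∃ f, 𝒩 x = res (m + Ψ (q • f)) := by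
    intro x hx
    refine exists_norm_eq_res_of_mem_closure 𝒩 res _ Ψ q (fun y hy ↦ ?_) hx
    obtain ⟨c, i, x₀, ⟨du, dv, hdu, hdv, rfl⟩, rfl⟩ := hy
    refine Tc c (Tconj i (Tc _ ?_))
    -- Kummer families of `u_k, v_k` over `K_k` and over `K_{k+n}`
    have huk : ∀ σ ∈ κ.layerSubgroup k, σ • C.u k = C.u k := fun σ hσ ↦ C.smul_u_eq hk hσ
    have hvk : ∀ σ ∈ κ.layerSubgroup k, σ • C.v k = C.v k := fun σ hσ ↦ C.smul_v_eq hk hσ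
    obtain ⟨duk, hduk⟩ := exists_isKummerFamilyOver (W.baseChange K) p (κ.layerSubgroup k) _ huk
    obtain ⟨dvk, hdvk⟩ := exists_isKummerFamilyOver (W.baseChange K) p (κ.layerSubgroup k) _ hvk
    have hduℓ := IsKummerFamilyOver.resPi hℓk hduk
    have hdvℓ := IsKummerFamilyOver.resPi hℓk hdvk
    obtain ⟨mα, hdesc⟩ := exists_sum_conjPi_kummerDiff_eq_unitRoot_pow_smul C hord hγ A B hA0 hA1 hA hB0 hB1 hB
      ns hv1 hvfix hnorm (ℓ := k + n) n k hk le_rfl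
      (hun := fun σ hσ ↦ C.smul_u_eq hkℓ' hσ) (hvn := fun σ hσ ↦ C.smul_v_eq hkℓ' hσ) hdu hdv hduℓ hdvℓ
    refine ⟨(W.baseChange K).padicPi p (κ.layerSubgroup k) (unitRoot W p ^ mα)
      (duk - (W.baseChange K).padicPi p (κ.layerSubgroup k) (Ring.inverse (unitRoot W p)) dvk),
      padicPi_mem_stabilizedModuleLayer γ C k hk _
        (kummerDiff_mem_stabilizedModuleLayer_lucas_of_le γ C hord hγ A B hA0 hA1 hA hB0 hB1 hB ns hv1 hvfix hnorm
          hk hk le_rfl hduk hdvk), 0, ?_⟩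
    rw [h𝒩ap, hdesc, smul_zero, map_zero, add_zero, hres, resPi_padicPi,
      map_sub ((W.baseChange K).resPi p hℓk), resPi_padicPi]
  -- (T5) the Kummer families of `u_j`, `v_j` over `K_{k+n}` for `δ < j ≤ k + n`
  have Tuv : ∀ (t j : ℕ), j = C.depth + 1 + t → j ≤ k + n →
      ∀ {hu : ∀ σ ∈ κ.layerSubgroup (k + n), σ • C.u j = C.u j}
        {hv : ∀ σ ∈ κ.layerSubgroup (k + n), σ • C.v j = C.v j}
        {du dv : (W.baseChange K).torsionH1Pi p (κ.layerSubgroup (k + n))},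
        (W.baseChange K).IsKummerFamilyOver p (κ.layerSubgroup (k + n)) hu du →
        (W.baseChange K).IsKummerFamilyOver p (κ.layerSubgroup (k + n)) hv dv →
        (∃ m ∈ stabilizedModuleLayer γ C k hk, ∃ f, 𝒩 du = res (m + Ψ (q • f))) ∧
          ∃ m ∈ stabilizedModuleLayer γ C k hk, ∃ f, 𝒩 dv = res (m + Ψ (q • f)) := by
    intro t
    induction t with
    | zero =>
      intro j hj hjℓ hu hv du dv hdu hdv
      obtain rfl : j = C.depth + 1 := by simpa using hj
      have hjd : C.depth < C.depth + 1 := Nat.lt_succ_self _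
      -- `v_{δ+1}` is residual
      obtain ⟨a, ha⟩ := hvρ
      have hTv : ∃ m ∈ stabilizedModuleLayer γ C k hk, ∃ f, 𝒩 dv = res (m + Ψ (q • f)) :=
        Tres a (IsKummerFamilyOver.of_eq ha.symm hdv)
      refine ⟨?_, hTv⟩
      have hD := TM _ (kummerDiff_mem_stabilizedModuleLayer_lucas_of_le γ C hord hγ A B hA0 hA1 hA hB0 hB1 hB ns
        hv1 hvfix hnorm hkℓ' hjd hjℓ hdu hdv)
      have hsum := exists_norm_eq_res_add 𝒩 res _ Ψ q hD (Tc (Ring.inverse (unitRoot W p)) hTv)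
      rwa [sub_add_cancel] at hsum
    | succ t ih =>
      intro j hj hjℓ hu hv du dv hdu hdv
      have hjd' : C.depth < C.depth + 1 + t := by omega
      have hjd : C.depth < j := by omega
      -- `v_j = u_{j-1}`: its Kummer family is that of `u_{j-1}`
      have hu₁ : ∀ σ ∈ κ.layerSubgroup (k + n), σ • C.u (C.depth + 1 + t) = C.u (C.depth + 1 + t) :=
        fun σ hσ ↦ C.smul_u_eq hjd' (κ.layerSubgroup_antitone (by omega) hσ)
      have hv₁ : ∀ σ ∈ κ.layerSubgroup (k + n), σ • C.v (C.depth + 1 + t) = C.v (C.depth + 1 + t) :=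
        fun σ hσ ↦ C.smul_v_eq hjd' (κ.layerSubgroup_antitone (by omega) hσ)
      obtain ⟨du₁, hdu₁⟩ := exists_isKummerFamilyOver (W.baseChange K) p (κ.layerSubgroup (k + n)) _ hu₁
      obtain ⟨dv₁, hdv₁⟩ := exists_isKummerFamilyOver (W.baseChange K) p (κ.layerSubgroup (k + n)) _ hv₁
      obtain ⟨hTu₁, hTv₁⟩ := ih _ rfl (by omega) hdu₁ hdv₁
      have hvj : C.v j = A (ns (C.depth + 1 + t)) • C.u (C.depth + 1 + t) +
          B (ns (C.depth + 1 + t)) • C.v (C.depth + 1 + t) := by rw [hj]; exact hv1 _ hjd'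
      have heqv : dv = A (ns (C.depth + 1 + t)) • du₁ + B (ns (C.depth + 1 + t)) • dv₁ :=
        IsKummerFamilyOver.unique p (IsKummerFamilyOver.of_eq hvj hdv)
          (IsKummerFamilyOver.add p (IsKummerFamilyOver.zsmul hdu₁ _) (IsKummerFamilyOver.zsmul hdv₁ _))
      have hTv : ∃ m ∈ stabilizedModuleLayer γ C k hk, ∃ f, 𝒩 dv = res (m + Ψ (q • f)) := by
        rw [heqv]
        exact exists_norm_eq_res_add 𝒩 res _ Ψ q (exists_norm_eq_res_zsmul 𝒩 res _ Ψ q _ hTu₁)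
          (exists_norm_eq_res_zsmul 𝒩 res _ Ψ q _ hTv₁)
      refine ⟨?_, hTv⟩
      have hD := TM _ (kummerDiff_mem_stabilizedModuleLayer_lucas_of_le γ C hord hγ A B hA0 hA1 hA hB0 hB1 hB ns
        hv1 hvfix hnorm hkℓ' hjd hjℓ hdu hdv)
      have hsum := exists_norm_eq_res_add 𝒩 res _ Ψ q hD (Tc (Ring.inverse (unitRoot W p)) hTv)
      rwa [sub_add_cancel] at hsum
  -- (T6) the generators of `ℋ̄_{k+n}(F)`
  have Tgen : ∀ (w : geomPoints (W.baseChange K)) (hw : w ∈ F.generators (k + n))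
      (d : (W.baseChange K).torsionH1Pi p (κ.layerSubgroup (k + n))),
      (W.baseChange K).IsKummerFamilyOver p (κ.layerSubgroup (k + n))
        (fun σ hσ ↦ F.smul_eq_of_mem_generators hw hσ) d →
      ∃ m ∈ stabilizedModuleLayer γ C k hk, ∃ f, 𝒩 d = res (m + Ψ (q • f)) := by
    intro w hw d hd
    rcases hw with hw | ⟨j, hj, hw⟩
    · -- `w = y`
      rw [Set.mem_singleton_iff] at hw
      subst hw
      obtain ⟨a, ha⟩ := hyρ
      exact Tres a (IsKummerFamilyOver.of_eq ha.symm hd)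
    · subst hw
      by_cases hjd : j ≤ C.depth
      · obtain ⟨a, ha⟩ := hzρ j hjd
        exact Tres a (IsKummerFamilyOver.of_eq ha.symm hd)
      · have hjd : C.depth < j := not_le.mp hjd
        obtain ⟨a, b, hzj⟩ := hz j hjd
        have huj : ∀ σ ∈ κ.layerSubgroup (k + n), σ • C.u j = C.u j :=
          fun σ hσ ↦ C.smul_u_eq hjd (κ.layerSubgroup_antitone hj hσ)
        have hvj : ∀ σ ∈ κ.layerSubgroup (k + n), σ • C.v j = C.v j :=
          fun σ hσ ↦ C.smul_v_eq hjd (κ.layerSubgroup_antitone hj hσ)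
        obtain ⟨du, hdu⟩ := exists_isKummerFamilyOver (W.baseChange K) p (κ.layerSubgroup (k + n)) _ huj
        obtain ⟨dv, hdv⟩ := exists_isKummerFamilyOver (W.baseChange K) p (κ.layerSubgroup (k + n)) _ hvj
        obtain ⟨hTu, hTv⟩ := Tuv (j - (C.depth + 1)) j (by omega) hj hdu hdv
        have hcomb := IsKummerFamilyOver.add p (IsKummerFamilyOver.zsmul hdu a) (IsKummerFamilyOver.zsmul hdv b)
        have heq : d = a • du + b • dv :=
          IsKummerFamilyOver.unique p hd (IsKummerFamilyOver.of_eq hzj.symm hcomb)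
        rw [heq]
        exact exists_norm_eq_res_add 𝒩 res _ Ψ q (exists_norm_eq_res_zsmul 𝒩 res _ Ψ q a hTu)
          (exists_norm_eq_res_zsmul 𝒩 res _ Ψ q b hTv)
  -- (T7) the whole level module `ℋ̄_{k+n}(F)`, in particular `proj_{k+n} s`
  have Ts : ∃ m ∈ stabilizedModuleLayer γ C k hk, ∃ f, 𝒩 (D.proj (k + n) s) = res (m + Ψ (q • f)) := by
    refine exists_norm_eq_res_of_mem_closure 𝒩 res _ Ψ q (fun y hy ↦ ?_) hs
    obtain ⟨c, i, w, hw, d, hd, rfl⟩ := hy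
    exact Tc c (Tconj i (Tgen w hw d hd))
  -- conclusion: universal norms + injectivity of restriction
  obtain ⟨m, hm, f, hf⟩ := Ts
  refine ⟨m, hm, f, (W.baseChange K).resPi_layer_injective_of_noPTorsion p κ hE hℓk ?_⟩
  rw [D.resPi_proj_eq_sum_conjPi_proj k n s, ← h𝒩ap, hf, hres, hΨ, map_add, map_add]
  congr 1
  rw [map_sum, map_sum]
  refine Finset.sum_congr rfl fun b _ ↦ ?_
  rw [hr', hq, Pi.smul_apply, smul_eq_mul]

end Residual

/-! ## §4 The forward envelope `ℋ_∞(F) ≤ Λκ_∞(C)` -/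

section Envelope

variable {N : ℕ} [NeZero N] {W : WeierstrassCurve ℚ} [W.IsGloballyMinimal] [W.IsElliptic] {K : Type u}
  [Field K] [NumberField K] {p : ℕ} [Fact p.Prime] {κ : ZpExtension K p} {γ : Field.absoluteGaloisGroup K}
  {jbar : AlgebraicClosure K →+* ℂ} (D : (W.baseChange K).LambdaAdicSelmerData κ γ)
  (F : HeegnerFamily N W K κ jbar) (C : StabilizedHeegnerData N W K κ jbar)

/-- **THE FORWARD ENVELOPE, SHARP: `ℋ_∞(F) ≤ Λκ_∞(C)`** for a coherent pair `(C, F)` — a CGLS `d(k)`-shifted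
stabilised datum `C` and a Howard family `F` whose points satisfy, above the torsion depth `δ`, the identities
(P1′) `v_{j+1} = A_{n_j} • u_j + B_{n_j} • v_j`, (P1″) `v_{j+1}` is `K_j`-rational, (P2′)
`Σ_{i<p} γ^{p^j i} • u_{j+1} = A_{n_j+1} • u_j + B_{n_j+1} • v_j` for an integer Lucas pair `(A, B)` (`A₀ = 1,
A₁ = a_p, B₀ = 0, B₁ = −1`, `X_{m+2} = a_pX_{m+1} − pX_m`) and jumps `n_j ≥ 0` (the printed case is `n_j = 0`:
`v_{j+1} = u_j`, `N u_{j+1} = a_p u_j − v_j`), and (P3) `z_j = a • u_j + b • v_j` (`a, b ∈ ℤ`) — at a good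
ordinary prime `p`, `γ` a topological generator, `E(K)[p] = 0`. This is the
statement «`κ_∞` and `κ₁^{Hg}` generate the same `Λ`-submodule» (CGLS Rem. 4.1.4) / «`𝐇` is generated by
`κ̃₁`» (Howard Thm. 3.3.7) in the direction `ℋ ⊆ Λκ`, at ANY class number and WITHOUT any `p`-power loss:
proved levelwise-modulo-residual + universal norms + Krull (module docstring).
[cite: CastellaGrossiLeeSkinner2022, Rem. 4.1.4 (arXiv:2008.02571v2 TeX L2278–2294)]
[cite: Howard2004HeegnerKolyvagin, Thm. 3.3.7 and §3.3] [cite: PerrinRiou1987BSMF, §3.4 Prop. 10, §0 p. 402] -/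
theorem heegnerModule_le_stabilizedHeegnerModule_of_coherent (hord : IsOrdinaryAt W p)
    (hγ : κ.IsTopGenerator γ) (hE : ∀ P : (W.baseChange K).toAffine.Point, p • P = 0 → P = 0)
    (A B : ℕ → ℤ) (hA0 : A 0 = 1) (hA1 : A 1 = W.frobeniusTrace p)
    (hA : ∀ m, A (m + 2) = W.frobeniusTrace p * A (m + 1) - p * A m)
    (hB0 : B 0 = 0) (hB1 : B 1 = -1) (hB : ∀ m, B (m + 2) = W.frobeniusTrace p * B (m + 1) - p * B m)
    (ns : ℕ → ℕ) (hv1 : ∀ j, C.depth < j → C.v (j + 1) = A (ns j) • C.u j + B (ns j) • C.v j)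
    (hvfix : ∀ j, C.depth < j → ∀ σ ∈ κ.layerSubgroup j, σ • C.v (j + 1) = C.v (j + 1))
    (hnorm : ∀ j, C.depth < j →
      ∑ i ∈ Finset.range p, (γ ^ (p ^ j * i)) • C.u (j + 1) = A (ns j + 1) • C.u j + B (ns j + 1) • C.v j)
    (hz : ∀ j, C.depth < j → ∃ a b : ℤ, F.z j = a • C.u j + b • C.v j) :
    heegnerModule D F ≤ stabilizedHeegnerModule D C := by
  -- the residual points: `z_j` (`j ≤ δ`), `y`, `v_{δ+1}`, all rational over `K_{δ+1}`
  let ρ : Option (Option (Fin (C.depth + 1))) → geomPoints (W.baseChange K) :=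
    fun a ↦ Option.elim a F.y fun b ↦ Option.elim b (C.v (C.depth + 1)) fun j ↦ F.z j
  have hρ : ∀ a, ∀ σ ∈ κ.layerSubgroup (C.depth + 1), σ • ρ a = ρ a := by
    rintro (_ | _ | j) σ hσ
    · exact F.isHeegnerNormPoint_y.smul_eq_self (κ.layerSubgroup_antitone (Nat.zero_le _) hσ)
    · exact C.smul_v_eq (Nat.lt_succ_self _) hσ
    · exact (F.isHeegnerNormPoint_z j).smul_eq_self
        (κ.layerSubgroup_antitone ((Nat.le_of_lt_succ j.2).trans (Nat.le_succ _)) hσ)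
  refine Submodule.span_le.mpr fun s hs ↦ mem_stabilizedHeegnerModule_of_proj_mem D C fun k hk ↦ ?_
  -- Kummer families of the residual points over `K_k`
  have hρk : ∀ a, ∀ σ ∈ κ.layerSubgroup k, σ • ρ a = ρ a :=
    fun a σ hσ ↦ hρ a σ (κ.layerSubgroup_antitone (Nat.succ_le_of_lt hk) hσ)
  choose r hr using fun a ↦ exists_isKummerFamilyOver (W.baseChange K) p (κ.layerSubgroup k) (ρ a) (hρk a)
  refine (W.baseChange K).mem_of_forall_eq_add_sum_padicPi_pow_mul p (κ.layerSubgroup k)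
    (stabilizedModuleLayer γ C k hk) (fun c _ hy ↦ padicPi_mem_stabilizedModuleLayer γ C k hk c hy)
    (fun b : Option (Option (Fin (C.depth + 1))) × Fin (p ^ k) ↦
      (W.baseChange K).conjPi p (κ.layerSubgroup k) (γ ^ (b.2 : ℕ)) (r b.1)) fun n ↦ ?_
  exact exists_proj_eq_add_sum_residual D F C hord hγ hE A B hA0 hA1 hA hB0 hB1 hB ns hv1 hvfix hnorm hz hk n ρ hρ
    ⟨none, rfl⟩ (fun j hj ↦ ⟨some (some ⟨j, Nat.lt_succ_of_le hj⟩), rfl⟩) ⟨some none, rfl⟩ r hr s (hs (k + n))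

end Envelope

end Literature.NumberTheory.EllipticCurves

end
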